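import Summits.Langlands.Langlands.Theses.EvenVoidBelowEight

/-!
# Birth skeleton (BC3) for crux stmt-Langlands-17642
`Summit.Langlands.Langlands.Theses.EvenVoidBelowEight.ThreeAdicInadequateImages` — line `birth`

THE CRUX (route `route-Langlands-EvenVoidBelowEight`, rank 2, planner-tagged open-problem): there is
no continuous EVEN `ρ : Γ_ℚ → GL₂(ℚ̄₃)`, unramified at all but finitely many places, de Rham at the
place above `3` for Fontaine's pinned datum with multiplicity-free labelled Hodge–Tate weights
(= distinct weights in rank 2), residually absolutely irreducible and non-dihedral, whose residual
PROJECTIVE image has order `12` (`A₄ ≅ PSL₂(𝔽₃)`, tetrahedral) or `360` (`A₆ ≅ PSL₂(𝔽₉)`).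
These are exactly the two 3-adic residual images at which every functorial shadow usable in
Calegari's chain (arXiv:1012.4819 §§3–4) is a catalogued adequacy exception
(arXiv:1405.0043 Thm 1.7 (ii),(iii)).

THE BIRTH SPLIT (the route's own TWO-LAYER PLAN for C1: "(order 12, tetrahedral) → (order 360, A₆)
→ C1").  The two images are cut apart because they fail the Taylor–Wiles adequacy hypotheses for
DIFFERENT reasons and therefore call for different engines:

* `stub_tetrahedral` — projective image of order `12` (`A₄`).  `Sym² ρ̄` restricted to the image is
  the 3-dimensional monomial representation of `A₄` (induced from the Klein four-group `V₄ ◁ A₄` of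
  index `3 = p`): it is not even weakly adequate (the semisimple elements span a 3-dimensional
  subalgebra of the 9-dimensional `End`), and `Sym^k ρ̄` is reducible for `k ≥ 3`.  Any proof must
  either patch with an ℓ-adically big / residually small image (Thorne, arXiv:1107.5993;
  Newton–Thorne arXiv:1912.11265) or exploit the residual INDUCED structure of `Sym² ρ̄` over the
  cubic field cut out by `V₄` (a solvable-base-change detour).
* `stub_alternatingSix` — projective image of order `360` (`A₆ ≅ PSL₂(𝔽₉)`).  Here the semisimple
  span condition holds but `H¹(PSL₂(𝔽₉), ad⁰) ≠ 0` (the exceptional `(3, PSL₂(9))` entry of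
  arXiv:1405.0043 Thm 1.7), so the obstruction is cohomological, not a span defect: a
  Diamond–Flach–Guo / "killing dual Selmer with extra primes despite `H¹ ≠ 0`" style engine, or an
  `Sym⁴`/tensor shadow of dimension `> p` with extended adequacy checked by hand, is what a proof
  must supply.

Neither stub implies the other, the crux, or the summit (BC3 probes in the planner folder,
`bc/probe_*.lean`: all FAIL as required); the crux implies each stub trivially (they are its two
cases).  The composition `ThreeAdicInadequateImages_of` is the case split on
`Nat.card (projectiveImage ρ̄) = 12 ∨ … = 360`, kernel-checked, no `sorry` outside the two `stub_*`.

Hypotheses kept verbatim from the crux in each stub (including `IsResiduallyAbsIrreducible` and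
`¬ IsDihedralType`, which are group-theoretically redundant given the image order — refuter note on
stmt-Langlands-17642 — but cost nothing and spare the stub prover a Dickson argument).

Disproof used: none — `Cruxes/ThreeAdicInadequateImages/` had no `Disproof.lean` and no landed
`Negative/` lemma at registration time (2026-08-17; `ledger crux ls stmt-Langlands-17642`: no
workfiles).  `ledger negatives --problem Langlands`: no statement about even 3-adic representations.
-/

set_option linter.dupNamespace false
set_option linter.unusedVariables false

noncomputable section

namespace Summit.Langlands.Langlands.Cruxes.ThreeAdicInadequateImages.Birth

open Summit.Langlands.Langlands.Theses.EvenVoidBelowEight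
open Literature.NumberTheory.GaloisRepresentations Literature.NumberTheory.PAdicHodge
open Filter

/-! ## 1. The open stubs -/

/-- **STUB 1 — the tetrahedral image (`|proj im ρ̄| = 12`, `A₄ ≅ PSL₂(𝔽₃)`).**  No even, almost
everywhere unramified `ρ : Γ_ℚ → GL₂(ℚ̄₃)`, de Rham above `3` (pinned Fontaine datum) with distinct
labelled Hodge–Tate weights, residually absolutely irreducible and non-dihedral, has residual
projective image of order `12`.  Why plausibly true: Fontaine–Mazur + the archimedean weight
dictionary predict no even regular geometric `ρ` at all; Calegari II proves the analogue for `p > 7`.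
Why it might fail / why it is hard: `(A₄, Sym²)` is not weakly adequate at `p = 3` (semisimple span
`3/9`), `Sym^k ρ̄` (`k ≥ 3`) is reducible for `SL₂(𝔽₃)`, tensor shadows have dimension `4 > p`; no
printed automorphy-lifting theorem applies.  Size: open-problem.
[cite: arXiv:1012.4819, Thm 1.1, Thm 1.2, §6] [cite: arXiv:1405.0043, Thm 1.7]
[cite: arXiv:1107.5993, Thm 1.2] [cite: arXiv:1912.11265] -/
theorem stub_tetrahedral :
    ∀ (ρ : Literature.NumberTheory.GaloisRepresentations.FramedGaloisRep ℚ (PadicAlgCl 3) 2), ρ.IsEven → (∀ᶠ v : IsDedekindDomain.HeightOneSpectrum (NumberField.RingOfIntegers ℚ) in Filter.cofinite, ρ.IsUnramifiedAt v) → (∀ (v : IsDedekindDomain.HeightOneSpectrum (NumberField.RingOfIntegers ℚ)) (hv : ((3 : ℕ) : NumberField.RingOfIntegers ℚ) ∈ v.asIdeal), (Literature.NumberTheory.PAdicHodge.fontainePstAdicCompletion v 3 hv).IsDeRhamFramed (ρ.toLocal v) ∧ ∀ τ : v.adicCompletion ℚ →+* PadicAlgCl 3, Continuous τ → (ρ.labelledHodgeTateWeightsAt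 v (Literature.NumberTheory.PAdicHodge.fontainePstAdicCompletion v 3 hv).algebra (Literature.NumberTheory.PAdicHodge.fontainePstAdicCompletion v 3 hv).𝔅 τ).Nodup) → ρ.IsResiduallyAbsIrreducible → ¬ Literature.NumberTheory.GaloisRepresentations.IsDihedralType ρ.residualRep → Nat.card (Literature.NumberTheory.GaloisRepresentations.projectiveImage ρ.residualRep) = 12 → False := by
  sorry

/-- **STUB 2 — the `A₆` image (`|proj im ρ̄| = 360`, `A₆ ≅ PSL₂(𝔽₉)`).**  No even, almost everywhere
unramified `ρ : Γ_ℚ → GL₂(ℚ̄₃)`, de Rham above `3` (pinned Fontaine datum) with distinct labelled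
Hodge–Tate weights, residually absolutely irreducible and non-dihedral, has residual projective
image of order `360`.  Why plausibly true: as for stub 1.  Why it might fail / why it is hard:
`(3, PSL₂(𝔽₉))` is the exceptional entry of the `d = p` adequacy classification —
`H¹(G, End(V)/k) ≠ 0` — so the Taylor–Wiles auxiliary-prime argument does not control the dual
Selmer group for the `Sym²` shadow, and higher shadows have dimension `> p`.  Size: open-problem.
[cite: arXiv:1012.4819, Thm 1.1, §6] [cite: arXiv:1405.0043, Thm 1.7, Cor 9.4]
[cite: arXiv:1311.1786, Thm 1.3] -/
theorem stub_alternatingSix :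
    ∀ (ρ : Literature.NumberTheory.GaloisRepresentations.FramedGaloisRep ℚ (PadicAlgCl 3) 2), ρ.IsEven → (∀ᶠ v : IsDedekindDomain.HeightOneSpectrum (NumberField.RingOfIntegers ℚ) in Filter.cofinite, ρ.IsUnramifiedAt v) → (∀ (v : IsDedekindDomain.HeightOneSpectrum (NumberField.RingOfIntegers ℚ)) (hv : ((3 : ℕ) : NumberField.RingOfIntegers ℚ) ∈ v.asIdeal), (Literature.NumberTheory.PAdicHodge.fontainePstAdicCompletion v 3 hv).IsDeRhamFramed (ρ.toLocal v) ∧ ∀ τ : v.adicCompletion ℚ →+* PadicAlgCl 3, Continuous τ → (ρ.labelledHodgeTateWeightsAt v (Literature.NumberTheory.PAdicHodge.fontainePstAdicCompletion v 3 hv).algebra (Literature.NumberTheory.PAdicHodge.fontainePstAdicCompletion v 3 hv).𝔅 τ).Nodup) → ρ.IsResiduallyAbsIrreducible → ¬ Literature.NumberTheory.GaloisRepresentations.IsDihedralType ρ.residualRep → Nat.card (Literature.NumberTheory.GaloisRepresentations.projectiveImage ρ.residualRep) = 360 → False := by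
  sorry

/-! ## 2. The stub statements as named `Prop`s (literally their types) -/

namespace _Goal

/-- The statement of `stub_tetrahedral`, as a named `Prop` (literally its type). [folklore] -/
def stub_tetrahedral : Prop :=
  type_of% @Summit.Langlands.Langlands.Cruxes.ThreeAdicInadequateImages.Birth.stub_tetrahedral

/-- The statement of `stub_alternatingSix`, as a named `Prop` (literally its type). [folklore] -/
def stub_alternatingSix : Prop :=
  type_of% @Summit.Langlands.Langlands.Cruxes.ThreeAdicInadequateImages.Birth.stub_alternatingSix

end _Goal

/-! ## 3. The composition (kernel-checked, no `sorry`): case split on the projective image order -/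

/-- **`ThreeAdicInadequateImages` from the two stubs.**  Fix the crux's context; the last hypothesis
is `Nat.card (projectiveImage ρ̄) = 12 ∨ Nat.card (projectiveImage ρ̄) = 360`; the first disjunct
is stub 1, the second stub 2.  The hypotheses are, by name, the statements of the two stubs; the
conclusion is the route decl
`Summit.Langlands.Langlands.Theses.EvenVoidBelowEight.ThreeAdicInadequateImages`. [folklore] -/
theorem ThreeAdicInadequateImages_of (h12 : _Goal.stub_tetrahedral)
    (h360 : _Goal.stub_alternatingSix) :
    Summit.Langlands.Langlands.Theses.EvenVoidBelowEight.ThreeAdicInadequateImages := by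
  -- the stub statements, as the Π-types they literally are
  have h12' : type_of% @stub_tetrahedral := h12
  have h360' : type_of% @stub_alternatingSix := h360
  intro ρ hev hur hdR hirr hdih himg
  rcases himg with h | h
  · exact h12' ρ hev hur hdR hirr hdih h
  · exact h360' ρ hev hur hdR hirr hdih h

/-- By-name sanity check (an `example`, not a declaration of the file): the two stubs feed the
composition as they stand. -/
example : Summit.Langlands.Langlands.Theses.EvenVoidBelowEight.ThreeAdicInadequateImages :=
  ThreeAdicInadequateImages_of stub_tetrahedral stub_alternatingSix

end Summit.Langlands.Langlands.Cruxes.ThreeAdicInadequateImages.Birth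

end
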